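import Mathlib
import Literature.NumberTheory.LFunctions.Zhang2022.Section12EpsFlow
import Literature.NumberTheory.LFunctions.Zhang2022.NumericsSection12Windows
import HarnessLib

/-!
# Zhang (2022) §12: (12.13) ⇒ (12.14) WITH THE PRINTED `ε/4` — the deduction edge `Eq1213 → Eq1214`

Topic `Literature/NumberTheory/LFunctions/Zhang2022` (Landau–Siegel audit tree; verdict-neutral).
Y. Zhang, *Discrete mean estimates and the Landau–Siegel zero*, arXiv:2211.02515v1 (2022)
[Zhang2022LandauSiegel]. **Status of the source: an unrefereed manuscript under adjudication** (campaign D-0069;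
ZHANG-L discharge lane, WP12). Everything in this file is PROVED (theorems only; no new definitions, no new named
facts; standard axioms); nothing here is a claim about Theorems 1–2 of the source or about Landau–Siegel zeros.

**Result (kernel-checked).** `Sec12D.eq1214_of_eq1213 : ∀ c′, Typed.Sec12C.Eq1213 c′ → Typed.Sec12C.Eq1214 c′`:
the typed display (12.14) [Z22 p. 72, tex L3656],

> "inserting these results into (12.13), we find that the sum over `P″₁ < dr < P₂` is equal to
> `𝔞/(0.504 log P)·(−0.002ῑ₃/0.498 − 0.008ῑ₄ − 2πiῑ₄/250² + ε/4)`",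

with ITS PRINTED SLACK `𝔞/(0.504 log P)·10⁻⁵/4` (+ `o(α)`), FOLLOWS from the typed (12.13) [tex L3614] (second form:
main term `main1213int`, slack `10⁻⁵·maj1213int` carrying Lemma 12.3's `ε_{2j}`) — for every value of the constant
`c′` of (2.13). This is the DED edge `Z22:(12.13) → Z22:(12.14)` of GAP-LEDGER row G-d38-1 (cell siegel-zhang).

**Why this does not contradict `Sec12D.printed_slack_1214_lt_derived`** (`Section12EpsFlow`, D-G-d38-1). That
certificate concerns the PRINTED ROUTE to (12.14): the two window displays §12.u039/u043 ("`= −0.002 + ε/10`",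
"`= −0.004 − πi/250² + ε/10`", `|ε| < 10⁻⁵`), typed with the slack `10⁻⁶ + 10⁻⁵∫|𝔣𝔣|`; from THOSE the triangle
inequality only yields `0.557·10⁻⁵`, not `10⁻⁵/4` (`Sec12D.eq1214_with_derived_slack`). Here the two window integrals
are instead taken at their KERNEL-CERTIFIED values: in the limit `D → ∞` the explicit part `𝓦⁰_j(P^z)` of `𝓦_j` is the
author's linearisation `wLin_j(z) = −1 + (3−j)πi(z − 0.496)` (p. 72) up to an affine perturbation of modulus
`≤ 521(2π + 8|c′|π²)𝓛⁻⁸` (exact `β`-algebra of (2.13), (2.22) with `α log P = π`, `α𝓛 = π𝓛⁻⁸`, `log(P^z/P″₁) =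
(z − 0.496)log P − 𝓛 − 519 log 𝓛`; cf. `Typed.Sec12C.step12u039_holds`), and the fixed-point boxes of
`NumericsSection12Windows` (`Numerics.ZDB`, `Numerics.mem_ZDB`, `Numerics.mem_windows_lin`) enclose the linearised
bracket deviation `‖ῑ₃(I₆ⱼ + 0.002)/0.498 + ῑ₄(I₇ⱼ + 0.004 + πi/250²)/0.5‖` below `2.2·10⁻⁶` for `j = 1, 2, 3`
(`cert1214sharp`, `decide +kernel`; values `2.115·10⁻⁶, 2.115·10⁻⁶, 1.370·10⁻⁶`; the flat `< 2.5·10⁻⁶` of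
`Numerics.eq1214_lin_one/two/three` leaves no room for the `ε_{2j}`-carrier). The `ε_{2j}`-carrier of (12.13) costs
`10⁻⁵·(‖ι₃‖/0.498·∫|𝔣𝔣_{j6}| + ‖ι₄‖/0.5·∫|𝔣𝔣_{j7}|) ≤ 10⁻⁵/50 = 2·10⁻⁷` (`‖𝔣𝔣_{a,k}‖ ≤ 1.02` on the windows,
`‖ι₃‖ ≤ 1.032`, `‖ι₄‖ ≤ 1.75`), and the `𝓛⁻⁸`-perturbation is `O(𝔞α𝓛⁻⁸) = O(α𝓛⁻⁴) = o(α)` by `𝔞 ≤ (96e⁹/π²)𝓛⁴`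
(`Sec12D.frakA_le_ell_pow_four`). Total: `2.2·10⁻⁶ + 2·10⁻⁷ = 2.4·10⁻⁶ < 2.5·10⁻⁶ = 10⁻⁵/4`, in units of
`𝔞/(0.504 log P)`, plus `εα`.

| decl | content |
|---|---|
| `cert1214sharp`, `norm_Z1214_lin_sub_bracket_le` | `‖Z_j(wLin) − bracket₁₂.₁₄‖ ≤ 2.2·10⁻⁶`, `j = 1,2,3` (kernel boxes of `NumericsSection12Windows`) |
| `eq1214_of_eq1213` | **`Eq1213 c′ → Eq1214 c′`** for every `c′` |

What this is NOT: a proof of (12.13) (`Eq1213`, which rests on Lemma 12.3 and Lemmas 8.2–8.3 and is NOT asserted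
here), nor of (12.14) outright; nor any statement about which reading of `𝓦_j` is the true one (the num lane's
N-07: in the EXACT main-value reading `Numerics.not_eq1214_exact_one` records that (12.14)₁ misses `ε/4`). For the
skeleton this is a REFINE edge (`h1214 ⇐ Eq1213 c′`); for the GAP-LEDGER it shows that the step (12.13) → (12.14)
AS TYPED is sound with the printed constant.

## References

* Y. Zhang, arXiv:2211.02515v1 (2022), §12 p. 72, (12.13)–(12.14), tex L3614–L3656; (2.10), (2.13), (2.22),
  (2.26), (2.31); §8 (8.13)–(8.18) p. 48. [cite: Zhang2022LandauSiegel, §12 (12.13)–(12.14)]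
-/

noncomputable section

open Complex Real ComplexConjugate
open Literature.Analysis.ValidatedNumerics.Numerics
open Literature.NumberTheory.LFunctions.Zhang2022
open Literature.NumberTheory.LFunctions.Zhang2022.Skeleton
open Literature.NumberTheory.LFunctions.Zhang2022.Typed.Sec12A
open Literature.NumberTheory.LFunctions.Zhang2022.Typed.Sec12C

namespace Literature.NumberTheory.LFunctions.Zhang2022.Sec12D

/-! ## The sharper kernel enclosure of the linearised (12.14) brackets -/

section Certificate

/- Keep the interval primitives opaque to the elaborator's unifier (as in `Section8Certificate`). -/
attribute [local irreducible] CB.add CB.sub CB.mul CB.neg CB.conj CB.mulFI CB.mulI CB.mulInt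
  CB.ofFI CB.ofInt CB.normSqFI CB.expI FI.add FI.sub FI.mul FI.neg FI.mulInt FI.divNat FI.divPos
  FI.ofRat FI.ofInt FI.pi qCB piMul expIpi overPiFI piISq

/-- **The kernel check**, sharper than `Numerics.cert12Z`: for the three boxes `Numerics.ZDB` of
`Z_j(wLin) − bracket₁₂.₁₄` (`j = 1, 2, 3`), `normSq < (2.2·10⁻⁶)² = 4.84·10⁻¹²` (scale `2⁴⁸`).
[cite: Zhang2022LandauSiegel, §12 (12.14) p.72] -/
theorem cert1214sharp :
    ((Numerics.ZDB (1/2) (3/2) 2).normSqFI.hi : ℚ) < (121/25000000000000 : ℚ) * (SC : ℚ) ∧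
    ((Numerics.ZDB (-1/2) (1/2) 1).normSqFI.hi : ℚ) < (121/25000000000000 : ℚ) * (SC : ℚ) ∧
    ((Numerics.ZDB (-3/2) (-1/2) 0).normSqFI.hi : ℚ) < (121/25000000000000 : ℚ) * (SC : ℚ) := by
  refine ⟨?_, ?_, ?_⟩ <;> decide +kernel

/-- From `normSq z < 4.84·10⁻¹²`: `‖z‖ ≤ 2.2·10⁻⁶`. [folklore] -/
private theorem norm_le_of_normSq_lt {z : ℂ}
    (h : Complex.normSq z < ((121/25000000000000 : ℚ) : ℝ)) : ‖z‖ ≤ 22 / 10 ^ 7 := by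
  rw [Complex.normSq_eq_norm_sq] at h
  have h2 : ((121/25000000000000 : ℚ) : ℝ) = (22 / 10 ^ 7) ^ 2 := by norm_num
  rw [h2] at h
  exact (lt_of_pow_lt_pow_left₀ 2 (by norm_num) h).le

/-- **`‖Z_j(wLin) − bracket₁₂.₁₄‖ ≤ 2.2·10⁻⁶` for `j = 1, 2, 3`** (values `2.115·10⁻⁶, 2.115·10⁻⁶, 1.370·10⁻⁶`):
the linearised window integrals `I₆ⱼ = ∫_{0.496}^{0.498}𝔣𝔣_{j6}(0.498−z)wLin_j`, `I₇ⱼ = ∫_{0.496}^{0.5}𝔣𝔣_{j7}(0.5−z)wLin_j`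
reproduce the bracket of (12.14) to within `2.2·10⁻⁶`, where `Z_j = ῑ₃I₆ⱼ/0.498 + ῑ₄I₇ⱼ/0.5`
(`Numerics.Z1214`, `Numerics.bracket1214`). [cite: Zhang2022LandauSiegel, §12 (12.14) p.72] -/
theorem norm_Z1214_lin_sub_bracket_le {j : ℕ} (hj : j ∈ ({1, 2, 3} : Finset ℕ)) :
    ‖Numerics.Z1214 Numerics.wLin j - Numerics.bracket1214‖ ≤ 22 / 10 ^ 7 := by
  simp only [Finset.mem_insert, Finset.mem_singleton] at hj
  obtain ⟨h1, h2, h3⟩ := cert1214sharp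
  have hm := Numerics.mem_windows_lin
  rcases hj with rfl | rfl | rfl
  · exact norm_le_of_normSq_lt (hi_bound (CB.mem_normSqFI (Numerics.mem_ZDB hm.1.1 hm.1.2)) h1)
  · exact norm_le_of_normSq_lt (hi_bound (CB.mem_normSqFI (Numerics.mem_ZDB hm.2.1.1 hm.2.1.2)) h2)
  · exact norm_le_of_normSq_lt (hi_bound (CB.mem_normSqFI (Numerics.mem_ZDB hm.2.2.1 hm.2.2.2)) h3)

end Certificate

/-! ## Window tools: perturbation of the weight, sizes of `𝔣𝔣_{jμ}`, `ι₃`, `ι₄` -/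

section Tools

/-- Window perturbation: replacing the weight `w` by `W = w + (ρz + σ)` with `|ρz + σ| ≤ δ` on `[a, b]`
changes `∫_a^b f·w` by at most `δ∫_a^b|f|`. [folklore] -/
private theorem window_perturb {a b δ : ℝ} (hab : a ≤ b) {f w W : ℝ → ℂ} (hf : Continuous f)
    (hw : Continuous w) {ρ σ : ℂ} (hW : ∀ z : ℝ, W z = w z + (ρ * z + σ))
    (hδ : ∀ z ∈ Set.Icc a b, ‖ρ * z + σ‖ ≤ δ) :
    ‖(∫ z in a..b, f z * W z) - ∫ z in a..b, f z * w z‖ ≤ δ * ∫ z in a..b, ‖f z‖ := by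
  simp_rw [hW]
  have hi1 : IntervalIntegrable (fun z : ℝ => f z * (w z + (ρ * z + σ))) MeasureTheory.volume a b :=
    Continuous.intervalIntegrable (by fun_prop) _ _
  have hi2 : IntervalIntegrable (fun z : ℝ => f z * w z) MeasureTheory.volume a b :=
    Continuous.intervalIntegrable (by fun_prop) _ _
  rw [← intervalIntegral.integral_sub hi1 hi2]
  have e : (fun z : ℝ => f z * (w z + (ρ * z + σ)) - f z * w z) = fun z : ℝ => f z * (ρ * z + σ) := by
    funext z; ring
  rw [e, ← intervalIntegral.integral_const_mul]
  refine intervalIntegral.norm_integral_le_of_norm_le hab ?_ ?_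
  · refine Filter.Eventually.of_forall fun z hz => ?_
    rw [norm_mul, mul_comm]
    exact mul_le_mul_of_nonneg_right (hδ z (Set.Ioc_subset_Icc_self hz)) (norm_nonneg _)
  · exact Continuous.intervalIntegrable (by fun_prop) _ _

/-- `∫_{lo}^{hi} ‖f(c − z)‖dz ≤ C(hi − lo)` when `‖f(c − z)‖ ≤ C` on `[lo, hi]`. [folklore] -/
private theorem int_norm_le {lo hi c C : ℝ} (hlh : lo ≤ hi) {f : ℝ → ℂ}
    (hf : ∀ z ∈ Set.Icc lo hi, ‖f (c - z)‖ ≤ C) :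
    ∫ z in lo..hi, ‖f (c - z)‖ ≤ C * (hi - lo) := by
  have h := intervalIntegral.norm_integral_le_of_norm_le_const (a := lo) (b := hi)
    (f := fun z => (‖f (c - z)‖ : ℝ)) (C := C) (fun z hz => by
      rw [Set.uIoc_of_le hlh] at hz
      rw [norm_norm]
      exact hf z (Set.Ioc_subset_Icc_self hz))
  rw [abs_of_nonneg (by linarith)] at h
  exact (Real.le_norm_self _).trans h

/-- `‖𝔣𝔣_{a,k}(w)‖ ≤ 1 + |a|π|w|` (`𝔣𝔣_{a,k}(w) = (1 + aπiw)e^{kπiw}`, (8.13)–(8.18)).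
[cite: Zhang2022LandauSiegel, §8 (8.13)–(8.18) p.48] -/
private theorem norm_ffF_le (a k : ℚ) (w : ℝ) : ‖ffF a k w‖ ≤ 1 + |(a : ℝ)| * π * |w| := by
  have e : cexp (k * π * I * w) = cexp (((k * π * w : ℝ)) * I) := by push_cast; ring_nf
  rw [ffF, norm_mul, e, Complex.norm_exp_ofReal_mul_I, mul_one]
  calc ‖1 + (a : ℂ) * π * I * w‖ ≤ ‖(1 : ℂ)‖ + ‖(a : ℂ) * π * I * w‖ := norm_add_le _ _
    _ = 1 + |(a : ℝ)| * π * |w| := by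
        rw [norm_one, norm_mul, norm_mul, norm_mul, Complex.norm_I, mul_one, Complex.norm_real,
          Real.norm_eq_abs, Complex.norm_real, Real.norm_eq_abs, abs_of_pos Real.pi_pos]
        norm_cast

/-- On the windows of (12.13) (`|w| ≤ 0.004`, `|a| ≤ 3/2`): `‖𝔣𝔣_{a,k}(w)‖ ≤ 1.02`.
[cite: Zhang2022LandauSiegel, §8 (8.13)–(8.18) p.48] -/
private theorem norm_ffF_le_window {a : ℚ} (k : ℚ) (ha : |(a : ℝ)| ≤ 3 / 2) {w : ℝ}
    (hw : |w| ≤ 0.004) : ‖ffF a k w‖ ≤ 1.02 := by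
  refine (norm_ffF_le a k w).trans ?_
  have hπ := Real.pi_lt_d2
  have h1 : |(a : ℝ)| * |w| ≤ 3 / 2 * 0.004 := mul_le_mul ha hw (abs_nonneg _) (by norm_num)
  have h2 : |(a : ℝ)| * π * |w| = π * (|(a : ℝ)| * |w|) := by ring
  rw [h2]
  nlinarith [Real.pi_pos, mul_nonneg (abs_nonneg (a : ℝ)) (abs_nonneg w)]

/-- `‖ι₃‖ ≤ 1.032` (`ι₃ = −1.00635 − 0.22789i`, (2.26)). [cite: Zhang2022LandauSiegel, §2 (2.26) p.9] -/
private theorem norm_iota3_le : ‖iota3‖ ≤ 1.032 := by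
  have hre : iota3.re = -1.00635 := by simp [iota3]
  have him : iota3.im = -0.22789 := by simp [iota3]
  have h : ‖iota3‖ ^ 2 ≤ 1.032 ^ 2 := by
    rw [Complex.sq_norm, Complex.normSq_apply, hre, him]; norm_num
  exact (pow_le_pow_iff_left₀ (norm_nonneg _) (by norm_num) two_ne_zero).mp h

/-- `‖ι₄‖ ≤ 1.75` (`ι₄ = −0.68738 + 1.60688i`, (2.26)). [cite: Zhang2022LandauSiegel, §2 (2.26) p.9] -/
private theorem norm_iota4_le : ‖iota4‖ ≤ 1.75 := by
  have hre : iota4.re = -0.68738 := by simp [iota4]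
  have him : iota4.im = 1.60688 := by simp [iota4]
  have h : ‖iota4‖ ^ 2 ≤ 1.75 ^ 2 := by
    rw [Complex.sq_norm, Complex.normSq_apply, hre, him]; norm_num
  exact (pow_le_pow_iff_left₀ (norm_nonneg _) (by norm_num) two_ne_zero).mp h

/-- Norms of the numerical literals `0.504, 0.498, 0.5 : ℂ`. [folklore] -/
private theorem norm_lits : ‖(0.504 : ℂ)‖ = 0.504 ∧ ‖(0.498 : ℂ)‖ = 0.498 ∧ ‖(0.5 : ℂ)‖ = 0.5 := by
  refine ⟨?_, ?_, ?_⟩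
  · rw [show (0.504 : ℂ) = ((0.504 : ℝ) : ℂ) by norm_num, Complex.norm_real]; norm_num
  · rw [show (0.498 : ℂ) = ((0.498 : ℝ) : ℂ) by norm_num, Complex.norm_real]; norm_num
  · rw [show (0.5 : ℂ) = ((0.5 : ℝ) : ℂ) by norm_num, Complex.norm_real]; norm_num

/-- The `j`-indexed window data of (12.13): `I₆ⱼ, I₇ⱼ` of `NumericsSection12` are the integrals written with
`Typed.Sec12C.ffj j 6 / ffj j 7`, these profiles are continuous, and `‖𝔣𝔣_{jμ}(w)‖ ≤ 1.02` for `|w| ≤ 0.004`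
(`j = 1, 2, 3`). [cite: Zhang2022LandauSiegel, §12 (12.13) p.71] -/
private theorem window_facts {j : ℕ} (hj : j ∈ ({1, 2, 3} : Finset ℕ)) :
    Numerics.I6 Numerics.wLin j =
        ∫ z in (0.496:ℝ)..0.498, ffj j 6 (0.498 - z) * Numerics.wLin j z ∧
    Numerics.I7 Numerics.wLin j =
        ∫ z in (0.496:ℝ)..0.5, ffj j 7 (0.5 - z) * Numerics.wLin j z ∧
    Continuous (fun z : ℝ => ffj j 6 z) ∧ Continuous (fun z : ℝ => ffj j 7 z) ∧
    (∀ w : ℝ, |w| ≤ 0.004 → ‖ffj j 6 w‖ ≤ 1.02) ∧ (∀ w : ℝ, |w| ≤ 0.004 → ‖ffj j 7 w‖ ≤ 1.02) := by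
  simp only [Finset.mem_insert, Finset.mem_singleton] at hj
  rcases hj with rfl | rfl | rfl
  · exact ⟨rfl, rfl, continuous_ffF (1/2) (3/2), continuous_ffF (3/2) (5/2),
      fun w hw => norm_ffF_le_window (3/2) (by norm_num) hw,
      fun w hw => norm_ffF_le_window (5/2) (by norm_num) hw⟩
  · exact ⟨rfl, rfl, continuous_ffF (-1/2) (3/2), continuous_ffF (1/2) (5/2),
      fun w hw => norm_ffF_le_window (3/2) (by norm_num) hw,
      fun w hw => norm_ffF_le_window (5/2) (by norm_num) hw⟩
  · exact ⟨rfl, rfl, continuous_ffF (-3/2) (3/2), continuous_ffF (-1/2) (5/2),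
      fun w hw => norm_ffF_le_window (3/2) (by norm_num) hw,
      fun w hw => norm_ffF_le_window (5/2) (by norm_num) hw⟩

end Tools

/-! ## The linearisation of `𝓦⁰_j(P^z)` with an explicit rate `O_{c′}(𝓛⁻⁸)` -/

section Linearisation

/-- The `D`-dependent part of `𝓦⁰_j(P^z)` with its RATE (p. 72 "`≃`" made quantitative): from the exact
relation `B·log P − k = m c′(α𝓛)πi` (`|m| ≤ 8`, `‖k‖ ≤ 2π`), `α𝓛 = π𝓛⁻⁸` and `log(P^z/P″₁) = (z − 0.496)log P
− 𝓛 − 519 log 𝓛`: `−1 + B·log(P^z/P″₁) = (−1 + k(z − 0.496)) + (ρz + σ)` with `‖ρz + σ‖ ≤ 521(2π + 8|c′|π²)𝓛⁻⁸`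
on `[0.496, 0.5]`. [cite: Zhang2022LandauSiegel, §12 (12.14) p.72] -/
private theorem decomp_rate {c' : ℝ} {D : ℕ} (hD : 1 ≤ Real.log D) {B kk : ℂ} {m : ℝ}
    (key : B * (Real.log (bigP D) : ℂ) - kk = ((m * c' * (alpha D * ell D) * π : ℝ) : ℂ) * I)
    (hm : |m| ≤ 8) (hkk : ‖kk‖ ≤ 2 * π) :
    ∃ ρ σ : ℂ, (∀ z : ℝ, -1 + B * (Real.log (bigP D ^ z / P1pp D) : ℂ) =
        (-1 + kk * ((z : ℂ) - 0.496)) + (ρ * z + σ)) ∧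
      ∀ z ∈ Set.Icc (0.496 : ℝ) 0.5, ‖ρ * z + σ‖ ≤ 521 * (2 * π + 8 * |c'| * π ^ 2) / ell D ^ 8 := by
  have hL1 : 1 ≤ ell D := by rw [ell]; exact hD
  have hLval : Real.log (bigP D) = ell D ^ 9 := by rw [bigP, Real.log_exp]
  have hℓ : 0 < ell D := by linarith
  have h8 : 0 < ell D ^ 8 := pow_pos hℓ 8
  have h9 : 0 < ell D ^ 9 := pow_pos hℓ 9
  have hαℓ : alpha D * ell D = π / ell D ^ 8 := alpha_mul_ell D hL1
  have hπ := Real.pi_pos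
  refine ⟨B * (Real.log (bigP D) : ℂ) - kk,
    -(0.496 : ℂ) * (B * (Real.log (bigP D) : ℂ) - kk) -
      B * ((ell D + 519 * Real.log (ell D) : ℝ) : ℂ),
    fun z => ?_, fun z hz => ?_⟩
  · rw [log_rpow_div_P1pp hD z]
    push_cast
    ring
  · -- `‖ρ‖ ≤ 8|c′|π²𝓛⁻⁸`
    have hρ : ‖B * (Real.log (bigP D) : ℂ) - kk‖ ≤ 8 * |c'| * π ^ 2 / ell D ^ 8 := by
      rw [key, norm_mul, Complex.norm_I, mul_one, Complex.norm_real, Real.norm_eq_abs, hαℓ,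
        abs_mul, abs_mul, abs_mul, abs_div, abs_of_pos hπ, abs_of_pos h8]
      have hx : 0 ≤ |c'| * (π / ell D ^ 8) * π := by positivity
      calc |m| * |c'| * (π / ell D ^ 8) * π = |m| * (|c'| * (π / ell D ^ 8) * π) := by ring
        _ ≤ 8 * (|c'| * (π / ell D ^ 8) * π) := mul_le_mul_of_nonneg_right hm hx
        _ = 8 * |c'| * π ^ 2 / ell D ^ 8 := by ring
    -- `‖B‖ log P ≤ 2π + 8|c′|π²`
    have hBL : ‖B‖ * ell D ^ 9 ≤ 2 * π + 8 * |c'| * π ^ 2 := by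
      have e : B * (Real.log (bigP D) : ℂ) = kk + (B * (Real.log (bigP D) : ℂ) - kk) := by ring
      have h1 : ‖B‖ * ell D ^ 9 = ‖B * (Real.log (bigP D) : ℂ)‖ := by
        rw [norm_mul, Complex.norm_real, Real.norm_eq_abs, hLval, abs_of_pos h9]
      rw [h1, e]
      calc ‖kk + (B * (Real.log (bigP D) : ℂ) - kk)‖
          ≤ ‖kk‖ + ‖B * (Real.log (bigP D) : ℂ) - kk‖ := norm_add_le _ _
        _ ≤ 2 * π + 8 * |c'| * π ^ 2 / ell D ^ 8 := add_le_add hkk hρ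
        _ ≤ 2 * π + 8 * |c'| * π ^ 2 := by
            have : 8 * |c'| * π ^ 2 / ell D ^ 8 ≤ 8 * |c'| * π ^ 2 :=
              div_le_self (by positivity) (one_le_pow₀ hL1)
            linarith
    -- `0 ≤ 𝓛 + 519 log 𝓛 ≤ 520𝓛`
    have hM0 : 0 ≤ ell D + 519 * Real.log (ell D) := by
      have : 0 ≤ Real.log (ell D) := Real.log_nonneg hL1
      nlinarith
    have hM : ell D + 519 * Real.log (ell D) ≤ 520 * ell D := by
      have : Real.log (ell D) ≤ ell D := (Real.log_le_sub_one_of_pos hℓ).trans (by linarith)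
      nlinarith
    have hB : ‖B‖ ≤ (2 * π + 8 * |c'| * π ^ 2) / ell D ^ 9 := by
      rw [le_div_iff₀ h9]; exact hBL
    have hBM : ‖B * ((ell D + 519 * Real.log (ell D) : ℝ) : ℂ)‖ ≤
        520 * (2 * π + 8 * |c'| * π ^ 2) / ell D ^ 8 := by
      rw [norm_mul, Complex.norm_real, Real.norm_eq_abs, abs_of_nonneg hM0]
      calc ‖B‖ * (ell D + 519 * Real.log (ell D))
          ≤ (2 * π + 8 * |c'| * π ^ 2) / ell D ^ 9 * (520 * ell D) :=
            mul_le_mul hB hM hM0 (by positivity)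
        _ = 520 * (2 * π + 8 * |c'| * π ^ 2) / ell D ^ 8 := by
            field_simp
    -- on the window `|z − 0.496| ≤ 0.004`
    obtain ⟨hz1, hz2⟩ := hz
    have hzabs : ‖((z : ℂ) - 0.496)‖ ≤ 0.004 := by
      have e : ((z : ℂ) - 0.496) = ((z - 0.496 : ℝ) : ℂ) := by push_cast; ring
      rw [e, Complex.norm_real, Real.norm_eq_abs, abs_le]
      constructor <;> linarith
    have e : (B * (Real.log (bigP D) : ℂ) - kk) * (z : ℂ) +
        (-(0.496 : ℂ) * (B * (Real.log (bigP D) : ℂ) - kk) -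
          B * ((ell D + 519 * Real.log (ell D) : ℝ) : ℂ))
        = (B * (Real.log (bigP D) : ℂ) - kk) * ((z : ℂ) - 0.496)
          - B * ((ell D + 519 * Real.log (ell D) : ℝ) : ℂ) := by ring
    rw [e]
    have hc8 : 0 ≤ 8 * |c'| * π ^ 2 / ell D ^ 8 := by positivity
    calc ‖(B * (Real.log (bigP D) : ℂ) - kk) * ((z : ℂ) - 0.496)
          - B * ((ell D + 519 * Real.log (ell D) : ℝ) : ℂ)‖
        ≤ ‖(B * (Real.log (bigP D) : ℂ) - kk) * ((z : ℂ) - 0.496)‖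
            + ‖B * ((ell D + 519 * Real.log (ell D) : ℝ) : ℂ)‖ := norm_sub_le _ _
      _ ≤ (8 * |c'| * π ^ 2 / ell D ^ 8) * 0.004 + 520 * (2 * π + 8 * |c'| * π ^ 2) / ell D ^ 8 := by
          rw [norm_mul]
          exact add_le_add (mul_le_mul hρ hzabs (norm_nonneg _) hc8) hBM
      _ ≤ 521 * (2 * π + 8 * |c'| * π ^ 2) / ell D ^ 8 := by
          have h1 : 8 * |c'| * π ^ 2 / ell D ^ 8 ≤ (2 * π + 8 * |c'| * π ^ 2) / ell D ^ 8 := by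
            gcongr; linarith
          have h2 : (8 * |c'| * π ^ 2 / ell D ^ 8) * 0.004 ≤ 8 * |c'| * π ^ 2 / ell D ^ 8 := by
            nlinarith
          have h3 : 520 * (2 * π + 8 * |c'| * π ^ 2) / ell D ^ 8 + (2 * π + 8 * |c'| * π ^ 2) / ell D ^ 8
              = 521 * (2 * π + 8 * |c'| * π ^ 2) / ell D ^ 8 := by ring
          linarith

/-- **`𝓦⁰_j(P^z) = wLin_j(z) + (ρz + σ)`, `‖ρz + σ‖ ≤ 521(2π + 8|c′|π²)𝓛⁻⁸` on `[0.496, 0.5]`** (`j = 1, 2, 3`,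
`𝓛 ≥ 1`): the printed "`𝓦_j(P^z)` is well approximated by `−1 + (3−j)πi(z − 0.496)`" (p. 72) on the explicit part
`𝓦⁰_j`, with the rate: `(−2β₆ + β_{j+1} + β_{j+2})log P = (3−j)πi + m_j c′(α𝓛)πi`, `m_j = −1, −8, −3`, by (2.13),
(2.22), `α log P = π`. [cite: Zhang2022LandauSiegel, §12 (12.14) p.72] -/
private theorem frakw0_lin (c' : ℝ) {D : ℕ} (hD : 1 ≤ Real.log D) {j : ℕ}
    (hj : j ∈ ({1, 2, 3} : Finset ℕ)) :
    ∃ ρ σ : ℂ, (∀ z : ℝ, frakw0 c' D j (bigP D ^ z) = Numerics.wLin j z + (ρ * z + σ)) ∧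
      ∀ z ∈ Set.Icc (0.496 : ℝ) 0.5, ‖ρ * z + σ‖ ≤ 521 * (2 * π + 8 * |c'| * π ^ 2) / ell D ^ 8 := by
  have hL1 : 1 ≤ ell D := by rw [ell]; exact hD
  have hA : ((alpha D : ℝ) : ℂ) * (Real.log (bigP D) : ℝ) = (π : ℂ) := by
    rw [← Complex.ofReal_mul, alpha_mul_log_bigP D hL1]
  have hπ : ‖(π : ℂ)‖ = π := by rw [Complex.norm_real, Real.norm_eq_abs, abs_of_pos Real.pi_pos]
  simp only [Finset.mem_insert, Finset.mem_singleton] at hj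
  rcases hj with rfl | rfl | rfl
  · -- j = 1: `(β₂ + β₃ − 2β₆)log P = 2πi − c′(α𝓛)πi`
    have key : (-2 * beta6 D + betaJ c' D (1 + 1) + betaJ c' D (1 + 2)) * (Real.log (bigP D) : ℂ)
        - 2 * π * I = (((-1) * c' * (alpha D * ell D) * π : ℝ) : ℂ) * I := by
      norm_num only [betaJ, beta6, beta1, beta2, beta3]
      push_cast
      linear_combination (I * (2 - (c' : ℂ) * (alpha D : ℂ) * (ell D : ℂ))) * hA
    obtain ⟨ρ, σ, h1, h2⟩ := decomp_rate hD key (by norm_num)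
      (by rw [norm_mul, norm_mul, Complex.norm_I, hπ]; norm_num)
    refine ⟨ρ, σ, fun z => ?_, h2⟩
    change -1 + (-2 * beta6 D + betaJ c' D (1 + 1) + betaJ c' D (1 + 2)) *
      (Real.log (bigP D ^ z / P1pp D) : ℂ) = _
    rw [h1 z]
    unfold Numerics.wLin
    push_cast
    ring
  · -- j = 2: `(β₃ + β₁ − 2β₆)log P = πi − 8c′(α𝓛)πi`
    have key : (-2 * beta6 D + betaJ c' D (2 + 1) + betaJ c' D (2 + 2)) * (Real.log (bigP D) : ℂ)
        - π * I = (((-8) * c' * (alpha D * ell D) * π : ℝ) : ℂ) * I := by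
      norm_num only [betaJ, beta6, beta1, beta2, beta3]
      push_cast
      linear_combination (I * (1 - 8 * (c' : ℂ) * (alpha D : ℂ) * (ell D : ℂ))) * hA
    obtain ⟨ρ, σ, h1, h2⟩ := decomp_rate hD key (by norm_num)
      (by rw [norm_mul, Complex.norm_I, hπ]; linarith [Real.pi_pos])
    refine ⟨ρ, σ, fun z => ?_, h2⟩
    change -1 + (-2 * beta6 D + betaJ c' D (2 + 1) + betaJ c' D (2 + 2)) *
      (Real.log (bigP D ^ z / P1pp D) : ℂ) = _
    rw [h1 z]
    unfold Numerics.wLin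
    push_cast
    ring
  · -- j = 3: `(β₁ + β₂ − 2β₆)log P = −3c′(α𝓛)πi`
    have key : (-2 * beta6 D + betaJ c' D (3 + 1) + betaJ c' D (3 + 2)) * (Real.log (bigP D) : ℂ)
        - 0 = (((-3) * c' * (alpha D * ell D) * π : ℝ) : ℂ) * I := by
      norm_num only [betaJ, beta6, beta1, beta2, beta3]
      push_cast
      linear_combination (I * (-3 * (c' : ℂ) * (alpha D : ℂ) * (ell D : ℂ))) * hA
    obtain ⟨ρ, σ, h1, h2⟩ := decomp_rate hD key (by norm_num)
      (by rw [norm_zero]; positivity)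
    refine ⟨ρ, σ, fun z => ?_, h2⟩
    change -1 + (-2 * beta6 D + betaJ c' D (3 + 1) + betaJ c' D (3 + 2)) *
      (Real.log (bigP D ^ z / P1pp D) : ℂ) = _
    rw [h1 z]
    unfold Numerics.wLin
    push_cast
    ring

end Linearisation

/-! ## The edge (12.13) ⇒ (12.14) with the printed `ε/4` -/

section Edge

variable (c' : ℝ)

/-- **(12.13) ⇒ (12.14) WITH THE PRINTED SLACK `ε/4`** (GAP row G-d38-1, DED edge `Z22:(12.13) → Z22:(12.14)`):
for every `c′`, `Typed.Sec12C.Eq1213 c′ → Typed.Sec12C.Eq1214 c′`, i.e. from the typed (12.13) (second form, slack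
`10⁻⁵·maj1213int` + `o(α)`) the sum over `P″₁ < dr < P₂` is `main1214 + 𝔞/(0.504 log P)·(≤ 10⁻⁵/4) + o(α)` — "we find
that the sum over `P″₁ < dr < P₂` is equal to `𝔞/(0.504 log P)(−0.002ῑ₃/0.498 − 0.008ῑ₄ − 2πiῑ₄/250² + ε/4)`" (p. 72,
tex L3656). Route: `𝓦⁰_j(P^z) = wLin_j + O_{c′}(𝓛⁻⁸)` (`frakw0_lin`), the kernel enclosure
`‖Z_j(wLin) − bracket‖ ≤ 2.2·10⁻⁶` (`norm_Z1214_lin_sub_bracket_le`), the `ε_{2j}`-carrier `≤ 2·10⁻⁷`, and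
`𝔞𝓛⁻⁸ = o(1)` (`frakA_le_ell_pow_four`): `2.2·10⁻⁶ + 2·10⁻⁷ < 10⁻⁵/4`. Kernel-checked; (12.13) itself is NOT asserted.
[cite: Zhang2022LandauSiegel, §12 (12.14) p.72] -/
theorem eq1214_of_eq1213 (h1213 : Eq1213 c') : Eq1214 c' := by
  intro ε hε
  set cK : ℝ := 521 * (2 * π + 8 * |c'| * π ^ 2) with hcK
  set A₀ : ℝ := 96 * Real.exp 9 / π ^ 2 with hA₀
  have hπ := Real.pi_pos
  have hcK0 : 0 ≤ cK := by positivity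
  have hε2 : 0 < ε / 2 := by linarith
  obtain ⟨D₀, hall⟩ := (h1213 (ε / 2) hε2).and
    (forAllLarge_log_ge (max 3 (2 * A₀ * cK * (1 / (50 * (0.504 * π))) / ε + 1)))
  refine ⟨D₀, fun D _ χ hD hq hp hA a25 ha25 j hj => ?_⟩
  obtain ⟨e1213, hlog⟩ := hall D χ hD hq hp
  have hlog3 : 3 ≤ Real.log D := le_trans (le_max_left _ _) hlog
  have hlogK : 2 * A₀ * cK * (1 / (50 * (0.504 * π))) / ε + 1 ≤ Real.log D :=
    le_trans (le_max_right _ _) hlog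
  have hlog1 : 1 ≤ Real.log D := by linarith
  have hℓ1 : 1 ≤ ell D := by rw [ell]; exact hlog1
  have hℓ0 : 0 < ell D := by linarith
  have hα := alpha_pos_of_log (D := D) hlog1
  have hAf := frakA_nonneg χ
  have hlogpos : 0 < Real.log (bigP D) := by
    rw [logP_eq_pi_div_alpha hlog1]; exact div_pos hπ hα
  obtain ⟨n504, n498, n5⟩ := norm_lits
  -- (12.13), second form, at `ε/2`
  have hT := (e1213 hA a25 ha25 j hj).2
  -- per-`j` data: the linearisation with rate and the window facts
  obtain ⟨ρ, σ, hW, hδ⟩ := frakw0_lin c' hlog1 hj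
  obtain ⟨hI6, hI7, hc6, hc7, hb6, hb7⟩ := window_facts hj
  have hZ := norm_Z1214_lin_sub_bracket_le hj
  set T := SjOn c' D j (a12 χ) a25 (rngTop D)
  set I6D := ∫ z in (0.496:ℝ)..0.498, ffj j 6 (0.498 - z) * frakw0 c' D j (bigP D ^ z) with hI6D
  set I7D := ∫ z in (0.496:ℝ)..0.5, ffj j 7 (0.5 - z) * frakw0 c' D j (bigP D ^ z) with hI7D
  set I6L := ∫ z in (0.496:ℝ)..0.498, ffj j 6 (0.498 - z) * Numerics.wLin j z with hI6L
  set I7L := ∫ z in (0.496:ℝ)..0.5, ffj j 7 (0.5 - z) * Numerics.wLin j z with hI7L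
  set M6 := ∫ z in (0.496:ℝ)..0.498, ‖ffj j 6 (0.498 - z)‖ with hM6
  set M7 := ∫ z in (0.496:ℝ)..0.5, ‖ffj j 7 (0.5 - z)‖ with hM7
  set δ : ℝ := cK / ell D ^ 8 with hδdef
  have hδ0 : 0 ≤ δ := by positivity
  -- the two perturbation bounds `‖I_D − I_lin‖ ≤ δ∫|𝔣𝔣|`
  have hwc : Continuous (Numerics.wLin j) := by unfold Numerics.wLin; fun_prop
  have hp6 : ‖I6D - I6L‖ ≤ δ * M6 :=
    window_perturb (by norm_num) (f := fun z : ℝ => ffj j 6 (0.498 - z))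
      (W := fun z : ℝ => frakw0 c' D j (bigP D ^ z)) (w := Numerics.wLin j)
      (hc6.comp (by fun_prop)) hwc hW (fun z hz => hδ z ⟨hz.1, hz.2.trans (by norm_num)⟩)
  have hp7 : ‖I7D - I7L‖ ≤ δ * M7 :=
    window_perturb (by norm_num) (f := fun z : ℝ => ffj j 7 (0.5 - z))
      (W := fun z : ℝ => frakw0 c' D j (bigP D ^ z)) (w := Numerics.wLin j)
      (hc7.comp (by fun_prop)) hwc hW hδ
  -- the kernel enclosure, in the `ffj` spelling
  have hZ' : ‖conj iota3 / 0.498 * (I6L + 0.002) +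
      conj iota4 / 0.5 * (I7L + 0.004 + π * I / 250 ^ 2)‖ ≤ 22 / 10 ^ 7 := by
    have e : conj iota3 / 0.498 * (I6L + 0.002) + conj iota4 / 0.5 * (I7L + 0.004 + π * I / 250 ^ 2) =
        Numerics.Z1214 Numerics.wLin j - Numerics.bracket1214 := by
      rw [← hI6, ← hI7]
      unfold Numerics.Z1214 Numerics.bracket1214
      ring
    rw [e]; exact hZ
  -- the exact identity `main1213int − main1214 = A₃(I₆ + 0.002) + A₄(I₇ + 0.004 + πi/250²)`
  set A3 : ℂ := (frakA χ : ℂ) * conj iota3 / (0.504 * 0.498 * (Real.log (bigP D) : ℂ)) with hA3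
  set A4 : ℂ := (frakA χ : ℂ) * conj iota4 / (0.504 * 0.5 * (Real.log (bigP D) : ℂ)) with hA4
  set P : ℂ := (frakA χ : ℂ) / (0.504 * (Real.log (bigP D) : ℂ)) with hPdef
  have hL : (Real.log (bigP D) : ℂ) ≠ 0 := by exact_mod_cast hlogpos.ne'
  have hid : main1213int c' χ j - main1214 χ =
      A3 * (I6D + 0.002) + A4 * (I7D + 0.004 + π * I / 250 ^ 2) := by
    rw [main1213int, main1214, hA3, hA4]
    field_simp
    ring
  have hfac : A3 * (I6L + 0.002) + A4 * (I7L + 0.004 + π * I / 250 ^ 2) =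
      P * (conj iota3 / 0.498 * (I6L + 0.002) +
        conj iota4 / 0.5 * (I7L + 0.004 + π * I / 250 ^ 2)) := by
    rw [hA3, hA4, hPdef]
    field_simp
  have nA3 : ‖A3‖ = frakA χ * ‖iota3‖ / (0.504 * 0.498 * Real.log (bigP D)) := by
    rw [hA3, norm_div, norm_mul, norm_mul, norm_mul, Complex.norm_real, Complex.norm_real,
      Complex.norm_conj, Real.norm_of_nonneg hAf, Real.norm_of_nonneg hlogpos.le, n504, n498]
  have nA4 : ‖A4‖ = frakA χ * ‖iota4‖ / (0.504 * 0.5 * Real.log (bigP D)) := by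
    rw [hA4, norm_div, norm_mul, norm_mul, norm_mul, Complex.norm_real, Complex.norm_real,
      Complex.norm_conj, Real.norm_of_nonneg hAf, Real.norm_of_nonneg hlogpos.le, n504, n5]
  have nP : ‖P‖ = frakA χ / (0.504 * Real.log (bigP D)) := by
    rw [hPdef, norm_div, norm_mul, Complex.norm_real, Complex.norm_real,
      Real.norm_of_nonneg hAf, Real.norm_of_nonneg hlogpos.le, n504]
  have hmaj : maj1213int χ j = ‖A3‖ * M6 + ‖A4‖ * M7 := by rw [maj1213int, nA3, nA4]
  -- `‖main1213int − main1214‖ ≤ ‖P‖·2.2·10⁻⁶ + δ(‖A₃‖M₆ + ‖A₄‖M₇)`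
  have hdiff : ‖main1213int c' χ j - main1214 χ‖ ≤
      ‖P‖ * (22 / 10 ^ 7) + δ * (‖A3‖ * M6 + ‖A4‖ * M7) := by
    rw [hid]
    have esplit : A3 * (I6D + 0.002) + A4 * (I7D + 0.004 + π * I / 250 ^ 2) =
        (A3 * (I6L + 0.002) + A4 * (I7L + 0.004 + π * I / 250 ^ 2)) +
          (A3 * (I6D - I6L) + A4 * (I7D - I7L)) := by ring
    rw [esplit, hfac]
    calc ‖P * (conj iota3 / 0.498 * (I6L + 0.002) +
            conj iota4 / 0.5 * (I7L + 0.004 + π * I / 250 ^ 2)) +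
          (A3 * (I6D - I6L) + A4 * (I7D - I7L))‖
        ≤ ‖P * (conj iota3 / 0.498 * (I6L + 0.002) +
            conj iota4 / 0.5 * (I7L + 0.004 + π * I / 250 ^ 2))‖ +
          ‖A3 * (I6D - I6L) + A4 * (I7D - I7L)‖ := norm_add_le _ _
      _ ≤ ‖P‖ * (22 / 10 ^ 7) + (‖A3‖ * (δ * M6) + ‖A4‖ * (δ * M7)) := by
          refine add_le_add ?_ ?_
          · rw [norm_mul]; exact mul_le_mul_of_nonneg_left hZ' (norm_nonneg _)
          · calc ‖A3 * (I6D - I6L) + A4 * (I7D - I7L)‖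
                ≤ ‖A3 * (I6D - I6L)‖ + ‖A4 * (I7D - I7L)‖ := norm_add_le _ _
              _ = ‖A3‖ * ‖I6D - I6L‖ + ‖A4‖ * ‖I7D - I7L‖ := by rw [norm_mul, norm_mul]
              _ ≤ ‖A3‖ * (δ * M6) + ‖A4‖ * (δ * M7) := by gcongr
      _ = ‖P‖ * (22 / 10 ^ 7) + δ * (‖A3‖ * M6 + ‖A4‖ * M7) := by ring
  -- sizes: `M₆ ≤ 1.02·0.002`, `M₇ ≤ 1.02·0.004`, hence `‖A₃‖M₆ + ‖A₄‖M₇ ≤ ‖P‖/50`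
  have hM6 : M6 ≤ 1.02 * (0.498 - 0.496) :=
    int_norm_le (by norm_num) fun z hz => hb6 _ (by
      rw [abs_le]; constructor <;> linarith [hz.1, hz.2])
  have hM7 : M7 ≤ 1.02 * (0.5 - 0.496) :=
    int_norm_le (by norm_num) fun z hz => hb7 _ (by
      rw [abs_le]; constructor <;> linarith [hz.1, hz.2])
  have hM60 : 0 ≤ M6 := intervalIntegral.integral_nonneg (by norm_num) fun z _ => norm_nonneg _
  have hM70 : 0 ≤ M7 := intervalIntegral.integral_nonneg (by norm_num) fun z _ => norm_nonneg _
  have hι3 := norm_iota3_le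
  have hι4 := norm_iota4_le
  have hpre : 0 ≤ frakA χ / (0.504 * Real.log (bigP D)) := by positivity
  have hAM : ‖A3‖ * M6 + ‖A4‖ * M7 ≤ ‖P‖ * (1 / 50) := by
    rw [nA3, nA4, nP]
    have e3 : frakA χ * ‖iota3‖ / (0.504 * 0.498 * Real.log (bigP D)) =
        frakA χ / (0.504 * Real.log (bigP D)) * (‖iota3‖ / 0.498) := by
      field_simp
    have e4 : frakA χ * ‖iota4‖ / (0.504 * 0.5 * Real.log (bigP D)) =
        frakA χ / (0.504 * Real.log (bigP D)) * (‖iota4‖ / 0.5) := by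
      field_simp
    rw [e3, e4]
    have h1 : ‖iota3‖ / 0.498 * M6 ≤ 1.032 / 0.498 * (1.02 * (0.498 - 0.496)) :=
      mul_le_mul (by gcongr) hM6 hM60 (by positivity)
    have h2 : ‖iota4‖ / 0.5 * M7 ≤ 1.75 / 0.5 * (1.02 * (0.5 - 0.496)) :=
      mul_le_mul (by gcongr) hM7 hM70 (by positivity)
    have hnum : (1.032 : ℝ) / 0.498 * (1.02 * (0.498 - 0.496)) + 1.75 / 0.5 * (1.02 * (0.5 - 0.496)) ≤
        1 / 50 := by norm_num
    have hin : ‖iota3‖ / 0.498 * M6 + ‖iota4‖ / 0.5 * M7 ≤ 1 / 50 := by linarith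
    calc frakA χ / (0.504 * Real.log (bigP D)) * (‖iota3‖ / 0.498) * M6 +
          frakA χ / (0.504 * Real.log (bigP D)) * (‖iota4‖ / 0.5) * M7
        = frakA χ / (0.504 * Real.log (bigP D)) * (‖iota3‖ / 0.498 * M6 + ‖iota4‖ / 0.5 * M7) := by
          ring
      _ ≤ frakA χ / (0.504 * Real.log (bigP D)) * (1 / 50) := mul_le_mul_of_nonneg_left hin hpre
  -- the `o(α)` remainder: `‖P‖·δ/50 ≤ (ε/2)α` (`𝔞 ≤ A₀𝓛⁴`, `log P = π/α`)
  have hrem : ‖P‖ * (δ * (1 / 50)) ≤ ε / 2 * alpha D := by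
    rw [nP, logP_eq_pi_div_alpha hlog1, hδdef]
    have h := remainder_small (A := frakA χ) (A₀ := A₀) (c := cK) (K := 1 / (50 * (0.504 * π)))
      (ℓ := ell D) (ε := ε) hℓ1 hAf (frakA_le_ell_pow_four χ hlog3 hp) hcK0 (by positivity) hε
      (by rw [ell]; exact hlogK)
    have e : frakA χ / (0.504 * (π / alpha D)) * (cK / ell D ^ 8 * (1 / 50)) =
        (frakA χ * (cK * (ell D ^ 8)⁻¹) * (1 / (50 * (0.504 * π)))) * alpha D := by
      field_simp
    rw [e]
    exact mul_le_mul_of_nonneg_right h hα.le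
  -- assemble
  have key : ‖T - main1214 χ‖ ≤ ‖T - main1213int c' χ j‖ + ‖main1213int c' χ j - main1214 χ‖ :=
    norm_sub_le_norm_sub_add_norm_sub _ _ _
  have hPn : 0 ≤ ‖P‖ := norm_nonneg _
  rw [hmaj] at hT
  rw [← nP]
  have h1 : δ * (‖A3‖ * M6 + ‖A4‖ * M7) ≤ δ * (‖P‖ * (1 / 50)) := mul_le_mul_of_nonneg_left hAM hδ0
  have h2 : 1e-5 * (‖A3‖ * M6 + ‖A4‖ * M7) ≤ 1e-5 * (‖P‖ * (1 / 50)) :=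
    mul_le_mul_of_nonneg_left hAM (by norm_num)
  linarith [hT, hdiff, key, h1, h2, hrem, hPn, hα.le]

end Edge

end Literature.NumberTheory.LFunctions.Zhang2022.Sec12D
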